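/-
Copyright (c) 2026. All rights reserved.
Released under Apache 2.0 license as described in the file LICENSE.
Authors: abc-iut cell, statement-typer seat abc-iut-L4-t9 (wave 2, block W2-B2), discharge.
-/
import Literature.AnabelianGeometry.AbsoluteAnabelian.AbsTopIII.BiAnabelianTelecore
import Literature.AnabelianGeometry.AbsoluteAnabelian.AbsTopIII.BiAnabelianObservableCells
import Literature.AnabelianGeometry.AbsoluteAnabelian.StrictHomotopyFamilies

/-!
# [AbsTopIII] Corollary 3.7 (iii) DISCHARGED: the observable `𝔖†_log` on `𝒟†_{≤2}` exists for every
# bi-anabelian setting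

S. Mochizuki, *Topics in absolute anabelian geometry III* [MochizukiAbsTopIII2015] (manuscript
`paper:url-5493eb38cbb7`; journal pagination not held), Cor 3.7 (iii) p. 88: "these natural
transformations `ι_{log,⋎}`, `ι_×` belong to a family of homotopies on `𝒟†_{≤3}` that determines on
`𝒟†_{≤3}` a structure of observable `𝔖†_log` on `𝒟†_{≤2}`"; proof "entirely similar to" that of Cor 3.6
(iii) p. 81: `E_log` = the pairs of the three types (1) `([λ^×]∘[id_⋎]∘[log]∘[γ], [λ^{×pf}]∘[id_{⋎+1}]∘[γ])`,
(2) `([λ^×]∘[γ], [λ^{×pf}]∘[γ])`, (3) `([γ],[γ])`, "one verifies immediately that `E_log` is saturated",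
and `ι_{log,⋎}` (resp. `ι_×`) — suitably pulled back along `γ` — are the homotopies of type (1) (resp.
(2)); here `pr_⋎ : 𝒳 ×_𝔈 𝒳 → 𝒳` plays the role of `id_⋎`.

Proof-only companion of `BiAnabelianIncompatibility.lean` (abc-iut-L4-t9), where the statement
`BiAnabelianSetting.ObservableLogStmt` (family on `𝒟†_{≤3}` GENERATED by `LogGen`, boundary paths
ending at `𝒩`, `ι_{log,⋎}`/`ι_×` PINNED on the generators) was typed.  This file CONSTRUCTS the family
for EVERY `𝔖 : BiAnabelianSetting X E N` and proves `observableLogStmt_holds : 𝔖.ObservableLogStmt`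
(hence `Cor_3_7_iii`).  Design: a pair of `E_log` together with its homotopy is a CELL
(`ObsCell`: type (3) `refl`, type (2) `times`, type (1) `log`, each behind a prefix path `γ`); the
boundary set `ObsRel` is "being the two sides of a cell"; a pair determines its cell (`ObsCell.ext'`),
so the homotopy of a pair is well defined (`obsEta`); the Def 3.5 (ii) axioms reduce to the facts
that no two non-reflexive cells compose and that cells are stable under prefixing; the family is
assembled by abc-iut-L4-t12's `HomotopyFamily.mkOfStrict` over the structural path functors.
(Same mathematics as abc-iut-L4-t10's `observableLogStmt_of_inl` for Cor 3.6 (iii), on the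
different oriented graph `Γ⃗_{𝒟†_{≤3}}` of Cor 3.7.)  Nothing here bears on [IUTchIII] Cor. 3.12.
-/

set_option autoImplicit false

namespace Literature.AnabelianGeometry.AbsoluteAnabelian.AbsTopIII

open CategoryTheory Quiver DiagramOfCategories

universe u

namespace BiAnabelianSetting

/-! ## The homotopies -/

variable {X E N : Type u} [Category.{u} X] [Category.{u} E] [Category.{u} N]
  (𝔖 : BiAnabelianSetting X E N)

/-- Last edges of equal one-edge extensions agree. [folklore] -/
private theorem edge_eq' {V : Type*} [Quiver V] {a b c : V} {p p' : Path a b} {e e' : b ⟶ c}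
    (h : p.cons e = p'.cons e') : e = e' :=
  eq_of_heq (Path.hom_heq_of_cons_eq_cons h)

/-- Three composable `eqToHom`s merge. [folklore] -/
private theorem eqToHom_comp₃ {C : Type*} [Category C] {W X Y Z : C} (b : W = X) (c : X = Y)
    (d : Y = Z) : eqToHom b ≫ eqToHom c ≫ eqToHom d = eqToHom (b.trans (c.trans d)) := by
  cases b; cases c; cases d; simp

/-- Left whiskering along propositionally equal functors. [folklore] -/
private theorem whiskerLeft_congr_left' {C₁ : Type*} [Category C₁] {C₂ : Type*} [Category C₂]
    {C₃ : Type*} [Category C₃] {F F' : C₁ ⥤ C₂} (hF : F = F') {G H : C₂ ⥤ C₃} (α : G ⟶ H) :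
    Functor.whiskerLeft F α =
      eqToHom (by rw [hF]) ≫ Functor.whiskerLeft F' α ≫ eqToHom (by rw [hF]) := by
  subst hF; simp

/-- **The homotopy of a cell** between the structural path functors of its two sides: the identity
(type (3)), "the result of applying `ι_×`" whiskered by `𝒟_[γ]` (type (2)), "the result of applying
`ι_{log,⋎}`" whiskered by `𝒟_[γ]` (type (1)). [cite: MochizukiAbsTopIII2015, Cor 3.7 (iii) p.88] -/
def cell : ∀ {a b : logObsShape.{u}.Vertex} (g : ObsCell.{u} a b),
    (𝔖.logObsDiagram.pathFunctor' g.left ⟶ 𝔖.logObsDiagram.pathFunctor' g.right)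
  | _, _, .refl _ _ => 𝟙 _
  | _, _, .times r => Functor.whiskerLeft (𝔖.logObsDiagram.pathFunctor' r) 𝔖.iotaTimes
  | _, _, .log _ r => Functor.whiskerLeft (𝔖.logObsDiagram.pathFunctor' r) 𝔖.iotaLogAt

/-- The homotopy of a reflexive cell is an identity. [cite: MochizukiAbsTopIII2015, Cor 3.7 (iii) p.88] -/
theorem cell_of_left_eq_right {a b : logObsShape.{u}.Vertex} (g : ObsCell.{u} a b)
    (e : g.left = g.right) (H : 𝔖.logObsDiagram.pathFunctor' g.left = 𝔖.logObsDiagram.pathFunctor' g.right) :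
    𝔖.cell g = eqToHom H := by
  cases g with
  | refl r f => rfl
  | times r => simp only [ObsCell.left, ObsCell.right] at e; exact absurd (edge_eq' e) eLamTimes_ne_eLamPf
  | log n r => simp only [ObsCell.left, ObsCell.right] at e; exact absurd (edge_eq' e) eLamTimes_ne_eLamPf

/-- Homotopies of prefixed cells are the whiskered homotopies (types (1), (2) "`∘[γ]`").
[cite: MochizukiAbsTopIII2015, Cor 3.7 (iii) p.88] -/
theorem cell_precomp {c a b : logObsShape.{u}.Vertex} (r₀ : Path c a) (g : ObsCell.{u} a b) :
    𝔖.cell (g.precomp r₀) =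
      eqToHom (by rw [ObsCell.left_precomp, pathFunctor'_comp]) ≫
        Functor.whiskerLeft (𝔖.logObsDiagram.pathFunctor' r₀) (𝔖.cell g) ≫
        eqToHom (by rw [ObsCell.right_precomp, pathFunctor'_comp]) := by
  cases g with
  | refl r f =>
    rw [𝔖.cell_of_left_eq_right ((ObsCell.refl r f).precomp r₀) rfl rfl,
      𝔖.cell_of_left_eq_right (ObsCell.refl r f) rfl rfl]
    ext x
    simp only [NatTrans.comp_app, eqToHom_app, Functor.whiskerLeft_app]
    exact (eqToHom_comp₃ _ _ _).symm
  | times r =>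
    show Functor.whiskerLeft (𝔖.logObsDiagram.pathFunctor' (r₀.comp r)) 𝔖.iotaTimes = _
    rw [whiskerLeft_congr_left' (𝔖.logObsDiagram.pathFunctor'_comp r₀ r) 𝔖.iotaTimes]
    rfl
  | log n r =>
    show Functor.whiskerLeft (𝔖.logObsDiagram.pathFunctor' (r₀.comp r)) 𝔖.iotaLogAt = _
    rw [whiskerLeft_congr_left' (𝔖.logObsDiagram.pathFunctor'_comp r₀ r) 𝔖.iotaLogAt]
    rfl

/-- The homotopy of a cell transported to a pair of paths equal to its sides. [cite: MochizukiAbsTopIII2015, Cor 3.7 (iii) p.88] -/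
def cellT {a b : logObsShape.{u}.Vertex} (g : ObsCell.{u} a b) {p q : Path a b} (hp : p = g.left)
    (hq : q = g.right) : (𝔖.logObsDiagram.pathFunctor' p ⟶ 𝔖.logObsDiagram.pathFunctor' q) :=
  eqToHom (by rw [hp]) ≫ 𝔖.cell g ≫ eqToHom (by rw [hq])

/-- **The homotopy `ζ_ϖ` of a pair `ϖ ∈ E_log`**: the homotopy of ITS cell (well defined by
`ObsCell.ext'`). [cite: MochizukiAbsTopIII2015, Cor 3.7 (iii) p.88] -/
noncomputable def obsEta {a b : logObsShape.{u}.Vertex} {p q : Path a b} (h : ObsRel p q) :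
    (𝔖.logObsDiagram.pathFunctor' p ⟶ 𝔖.logObsDiagram.pathFunctor' q) :=
  𝔖.cellT h.out.choose h.out.choose_spec.1 h.out.choose_spec.2

/-- `ζ_ϖ` is the homotopy of any cell with sides `ϖ`. [cite: MochizukiAbsTopIII2015, Cor 3.7 (iii) p.88] -/
theorem obsEta_eq {a b : logObsShape.{u}.Vertex} {p q : Path a b} (h : ObsRel p q) (g : ObsCell.{u} a b)
    (hp : p = g.left) (hq : q = g.right) : 𝔖.obsEta h = 𝔖.cellT g hp hq := by
  obtain rfl : h.out.choose = g :=
    ObsCell.ext' (h.out.choose_spec.1.symm.trans hp) (h.out.choose_spec.2.symm.trans hq)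
  rfl

/-- Def 3.5 (ii): `ζ_{([γ],[γ])}` is the identity. [cite: MochizukiAbsTopIII2015, Cor 3.7 (iii) p.88] -/
theorem obsEta_refl {a b : logObsShape.{u}.Vertex} {p : Path a b} (h : ObsRel p p) :
    𝔖.obsEta h = 𝟙 _ := by
  obtain ⟨g, hp, hq⟩ := h.out
  rw [𝔖.obsEta_eq h g hp hq, cellT,
    𝔖.cell_of_left_eq_right g (hp.symm.trans hq) (by rw [← hp, ← hq])]
  simp

/-- Def 3.5 (ii): `ζ_{ϖ''} = ζ_{ϖ'} ∘ ζ_ϖ` (one of the two is always an identity).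
[cite: MochizukiAbsTopIII2015, Cor 3.7 (iii) p.88] -/
theorem obsEta_trans {a b : logObsShape.{u}.Vertex} {p q r : Path a b} (h₁ : ObsRel p q)
    (h₂ : ObsRel q r) :
    𝔖.obsEta (isSaturated_obsRel.trans h₁ h₂) = 𝔖.obsEta h₁ ≫ 𝔖.obsEta h₂ := by
  obtain ⟨g₁, rfl, rfl⟩ := h₁.out
  obtain ⟨g₂, e, rfl⟩ := h₂.out
  rcases ObsCell.dichotomy e with e' | e'
  · rw [𝔖.obsEta_eq h₁ g₁ rfl rfl, 𝔖.obsEta_eq h₂ g₂ e rfl, 𝔖.obsEta_eq _ g₂ (e'.trans e) rfl,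
      cellT, cellT, cellT, 𝔖.cell_of_left_eq_right g₁ e' (by rw [e'])]
    simp
  · rw [𝔖.obsEta_eq h₁ g₁ rfl rfl, 𝔖.obsEta_eq h₂ g₂ e rfl,
      𝔖.obsEta_eq _ g₁ rfl (e'.trans e.symm), cellT, cellT, cellT,
      𝔖.cell_of_left_eq_right g₂ e'.symm (by rw [e'])]
    simp

/-- Def 3.5 (ii): the whiskering axiom (post-composition is trivial — boundary paths end at `𝒩` —
and pre-composition by `[γ]` prefixes the cell). [cite: MochizukiAbsTopIII2015, Cor 3.7 (iii) p.88] -/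
theorem obsEta_whisker {a b c d : logObsShape.{u}.Vertex} {p q : Path a b} (h : ObsRel p q)
    (r₁ : Path c a) (r₂ : Path b d) :
    𝔖.obsEta (isSaturated_obsRel.precomp (isSaturated_obsRel.postcomp h r₂) r₁) =
      eqToHom (by rw [pathFunctor'_comp, pathFunctor'_comp]) ≫
        Functor.whiskerLeft (𝔖.logObsDiagram.pathFunctor' r₁)
          (Functor.whiskerRight (𝔖.obsEta h) (𝔖.logObsDiagram.pathFunctor' r₂)) ≫
        eqToHom (by rw [pathFunctor'_comp, pathFunctor'_comp]) := by
  obtain ⟨g, rfl, rfl⟩ := h.out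
  obtain rfl := g.eq_obs
  obtain ⟨rfl, hr⟩ := path_from_lvObs r₂
  cases hr
  rw [𝔖.obsEta_eq h g rfl rfl,
    𝔖.obsEta_eq _ (g.precomp r₁) (by rw [ObsCell.left_precomp]; rfl)
      (by rw [ObsCell.right_precomp]; rfl), cellT, cellT, 𝔖.cell_precomp r₁ g]
  ext x
  simp only [NatTrans.comp_app, eqToHom_app, Functor.whiskerLeft_app, Functor.whiskerRight_app,
    pathFunctor'_nil, Functor.id_map, eqToHom_refl, Category.id_comp, Category.comp_id,
    Category.assoc, eqToHom_trans, eqToHom_trans_assoc]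
  rfl

/-- **The family of homotopies `𝔖†_log`** on `𝒟†_{≤3}`: boundary set `E_log` (`ObsRel`), homotopies
`obsEta`, transported to the path functors of `DiagramsOfCategories.lean` by `mkOfStrict`.
[cite: MochizukiAbsTopIII2015, Cor 3.7 (iii) p.88] -/
noncomputable def obsFamily : 𝔖.logObsDiagram.HomotopyFamily :=
  HomotopyFamily.mkOfStrict ObsRel.{u} isSaturated_obsRel (fun _ _ _ _ h => 𝔖.obsEta h)
    (fun _ _ _ h => 𝔖.obsEta_refl h) (fun _ _ _ _ _ h₁ h₂ => 𝔖.obsEta_trans h₁ h₂)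
    (fun _ _ _ _ _ _ h r₁ r₂ => 𝔖.obsEta_whisker h r₁ r₂)

/-- Computation rule for the homotopies of `obsFamily`. [cite: MochizukiAbsTopIII2015, Cor 3.7 (iii) p.88] -/
theorem obsFamily_η {a b : logObsShape.{u}.Vertex} {p q : Path a b} (h : ObsRel p q) :
    𝔖.obsFamily.η h = eqToHom (𝔖.logObsDiagram.pathFunctor_eq_pathFunctor' p) ≫ 𝔖.obsEta h ≫
      eqToHom (𝔖.logObsDiagram.pathFunctor_eq_pathFunctor' q).symm := rfl

/-! ## Cor 3.7 (iii) discharged -/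

/-- **Cor 3.7 (iii), DISCHARGED for every bi-anabelian setting**: "these natural transformations
`ι_{log,⋎}`, `ι_×` belong to a family of homotopies on `𝒟†_{≤3}` that determines on `𝒟†_{≤3}` a structure
of observable `𝔖†_log` on `𝒟†_{≤2}`" — the family `obsFamily` is generated by the printed pairs
(`LogGen`), its boundary paths end at `𝒩`, and `ι_×` / `ι_{log,⋎}` ARE its homotopies on the generators.
[cite: MochizukiAbsTopIII2015, Cor 3.7 (iii) p.88] -/
theorem observableLogStmt_holds :
    Literature.AnabelianGeometry.AbsoluteAnabelian.AbsTopIII.BiAnabelianSetting.ObservableLogStmt 𝔖 := by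
  refine ⟨𝔖.obsFamily, fun a b p q => obsRel_iff_saturation p q, fun a b p q h => ?_, ?_, ?_⟩
  · obtain ⟨g, -, -⟩ := ObsRel.out h
    exact g.eq_obs
  · refine ⟨ObsRel.mk (ObsCell.times Path.nil), fun x e₁ e₂ => ?_⟩
    rw [obsFamily_η, 𝔖.obsEta_eq (p := timesPairLeft.{u}) (q := timesPairRight.{u}) _
      (ObsCell.times Path.nil) rfl rfl]
    simp only [cellT, cell, NatTrans.comp_app, eqToHom_app, Functor.whiskerLeft_app, eqToHom_trans,
      eqToHom_trans_assoc, Category.assoc]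
    rfl
  · intro n
    refine ⟨ObsRel.mk (ObsCell.log n Path.nil), fun o e₁ e₂ => ?_⟩
    rw [obsFamily_η, 𝔖.obsEta_eq (p := logPairLeft.{u} n) (q := logPairRight.{u} n) _
      (ObsCell.log n Path.nil) rfl rfl]
    simp only [cellT, cell, NatTrans.comp_app, eqToHom_app, Functor.whiskerLeft_app, eqToHom_trans,
      eqToHom_trans_assoc, Category.assoc]
    rfl

/-- `ObservableLogStmt` — `_holds` alias of `observableLogStmt_holds` above under the fact's exact name (appended
2026-08-28, D-0026 bookkeeping: the proof term is the existing theorem of this file; no statement,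
definition or attribute is edited; no new named fact; the ledger's debt table listed the fact
unproved). [cite: MochizukiAbsTopIII2015, Cor 3.7 (iii) p.88] -/
theorem _root_.Literature.AnabelianGeometry.AbsoluteAnabelian.AbsTopIII.BiAnabelianSetting.ObservableLogStmt_holds :
    Literature.AnabelianGeometry.AbsoluteAnabelian.AbsTopIII.BiAnabelianSetting.ObservableLogStmt 𝔖 :=
  _root_.Literature.AnabelianGeometry.AbsoluteAnabelian.AbsTopIII.BiAnabelianSetting.observableLogStmt_holds (𝔖 := 𝔖)

/-- `Cor_3_7_iii` (= `ObservableLogStmt`) holds for every setting.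
[cite: MochizukiAbsTopIII2015, Cor 3.7 (iii) p.88] -/
theorem cor_3_7_iii_holds :
    Literature.AnabelianGeometry.AbsoluteAnabelian.AbsTopIII.BiAnabelianSetting.Cor_3_7_iii 𝔖 :=
  𝔖.observableLogStmt_holds

/-- `Cor_3_7_iii` — `_holds` alias of `cor_3_7_iii_holds` above under the fact's exact name (appended
2026-08-28, D-0026 bookkeeping: the proof term is the existing theorem of this file; no statement,
definition or attribute is edited; no new named fact; the ledger's debt table listed the fact
unproved). [cite: MochizukiAbsTopIII2015, Cor 3.7 (iii) p.88] -/
theorem _root_.Literature.AnabelianGeometry.AbsoluteAnabelian.AbsTopIII.BiAnabelianSetting.Cor_3_7_iii_holds :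
    Literature.AnabelianGeometry.AbsoluteAnabelian.AbsTopIII.BiAnabelianSetting.Cor_3_7_iii 𝔖 :=
  _root_.Literature.AnabelianGeometry.AbsoluteAnabelian.AbsTopIII.BiAnabelianSetting.cor_3_7_iii_holds (𝔖 := 𝔖)

end BiAnabelianSetting

end Literature.AnabelianGeometry.AbsoluteAnabelian.AbsTopIII
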